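import Literature.Probability.LatticeModels.ScaleFrameQuasiMultUpper
import Literature.Probability.LatticeModels.ScaleFrameQuasiMultGlue
import HarnessLib

/-!
# Kesten's ratio forgetting along a scale frame: deterministic path lemmas (proved)

Topic `Literature/Probability/LatticeModels` (trunk `StatMech`, family `crit-ising`). The
combinatorial inputs of the multi-level ratio-forgetting argument of H. Kesten (PTRF 73 (1986),
§2, proof of Thm. 3, eqs. (16)–(25)) run with the exploration-from-inside data of D. Basu,
A. Sapozhnikov (ECP 22 (2017), §2) on a `ScaleFrame`:

* `rimWiredOff_of_agree_on_block`, `ScaleFrame.datumOff_iff_of_agree_on_block` — the datum event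
  "explored set `U`, rim `R`, rim wired OFF the inside" of the block `annSet b top` explored from
  `inSet b` is determined by the edges touching the block (E3 of `BlockExplorationBasic.lean` plus
  the wiring clause, whose pairs issue from `U ∖ inSet b ⊆ annSet b top`);
* `pathIn_explSet_diff`, `ScaleFrame.rimWiredOff_of_sepEvent` — an open separator of a sub-annulus
  `(bM^i, bM^{i+1})`, `i + 1 ≤ m`, of the block `(b, bM^m)` wires the rim off the inside: the
  exploring path of the explored neighbour of a rim vertex, read backwards, meets the separator
  before it can dip below scale `bM^i` (Kesten's "innermost circuit" replaced by a separator, as in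
  Basu–Sapozhnikov's uniqueness event);
* `midPiece_iff_openCrossing` — on a nested pair of data the middle piece of the chain
  decomposition ("an inner-rim vertex is joined inside `U_C ∖ U_D` to a vertex carrying an open edge
  to the outer rim") is the open crossing from the inner rim to the outer rim inside
  `(U_C ∪ R_C) ∖ U_D` (first exit from `U_C`);
* measure-theoretic trivia for the free random-cluster measure: an event missing the empty
  configuration is null at `p = 0`, a non-null event contains a lattice configuration, a lattice
  configuration has positive mass for `0 < p < 1`.

Everything is proved; no definitions.

## References
* [Kesten1986] H. Kesten, Probab. Theory Related Fields 73 (1986) 369–394, §2, proof of Thm. 3.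
* [BasuSapozhnikov2017ECP] D. Basu, A. Sapozhnikov, ECP 22 (2017) no. 26, §2.
* G. Grimmett, *The Random-Cluster Model*, Springer (2006), §1.2.
-/

open MeasureTheory Finset SimpleGraph
open Literature.Probability.Percolation (BondConfig openConnIn openCrossing openGraph explSet explRim
  explEvent PathIn)

namespace Literature.Probability.LatticeModels

variable {V : Type*}

/-! ### The off-wired datum event is determined by the edges touching the block -/

/-- The wiring of the rim off the inside passes between configurations agreeing on the pairs
touching the block, on the datum event (the wiring pairs issue from `U ∖ In ⊆ Blk`).
[cite: BasuSapozhnikov2017ECP, §2, paragraph after eq. (2.3)] -/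
theorem rimWiredOff_of_agree_on_block {In Blk U R : Set V} {ωa ωb : BondConfig V}
    (hag : ∀ e : Sym2 V, (∃ v ∈ Blk, v ∈ e) → (e ∈ ωa ↔ e ∈ ωb))
    (hE : ωa ∈ explEvent In Blk U R)
    (hW : ∀ r ∈ R, ∀ r₂ ∈ R, ∃ v ∈ U \ In, ∃ v' ∈ U \ In,
      s(v, r) ∈ ωa ∧ s(v', r₂) ∈ ωa ∧ ωa ∈ openConnIn (U \ In) v v') :
    ∀ r ∈ R, ∀ r₂ ∈ R, ∃ v ∈ U \ In, ∃ v' ∈ U \ In,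
      s(v, r) ∈ ωb ∧ s(v', r₂) ∈ ωb ∧ ωb ∈ openConnIn (U \ In) v v' := by
  have hUB : ∀ v ∈ U \ In, v ∈ Blk := fun v hv => by
    obtain ⟨h1, -⟩ := Percolation.mem_explEvent_iff.1 hE
    rw [← h1] at hv
    exact (Percolation.explSet_subset In Blk ωa hv.1).resolve_left hv.2
  intro r hr r₂ hr₂
  obtain ⟨v, hv, v', hv', h1, h2, h3⟩ := hW r hr r₂ hr₂
  exact ⟨v, hv, v', hv', (hag _ ⟨v, hUB v hv, Sym2.mem_mk_left v r⟩).1 h1,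
    (hag _ ⟨v', hUB v' hv', Sym2.mem_mk_left v' r₂⟩).1 h2,
    Percolation.BlockExploration.openConnIn_of_agree h3 fun a ha b _ hab =>
      (hag _ ⟨a, hUB a ha, Sym2.mem_mk_left a b⟩).1 hab⟩

/-- **(Det) The off-wired datum event of a block of a scale frame is determined by the edges
touching the block.** For the block `annSet b top` explored from `inSet b` (`b + η ≤ top ≤ Rmax`),
a set of frame pairs `Eg ⊆ E` and two configurations agreeing on the pairs of `Eg` touching the
block, the saturated events `{ω ∩ Eg ∈ {𝒞 = U, 𝒟 = R} ∩ {rim wired through U ∖ inSet b}}` agree: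
no frame edge leads from `inSet b` out of `inSet b ∪ annSet b top`, so E3 applies, and the wiring
pairs touch the block. [cite: BasuSapozhnikov2017ECP, §2, paragraph after eq. (2.3)] -/
theorem ScaleFrame.datumOff_iff_of_agree_on_block [Fintype V] [DecidableEq V] (F : ScaleFrame V)
    {b top : ℝ} (hbt : b + F.η ≤ top) (htop : top ≤ F.Rmax) {Eg : Set (Sym2 V)}
    (hEg : Eg ⊆ ↑F.E) {U R : Set V} {ω₁ ω₂ : BondConfig V}
    (hag : ∀ e ∈ Eg, (∃ v ∈ e, v ∈ F.annSet b top) → (e ∈ ω₁ ↔ e ∈ ω₂)) :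
    ω₁ ∩ Eg ∈ explEvent (F.inSet b) (F.annSet b top) U R ∩
        {ω | ∀ r ∈ R, ∀ r₂ ∈ R, ∃ v ∈ U \ F.inSet b, ∃ v' ∈ U \ F.inSet b,
          s(v, r) ∈ ω ∧ s(v', r₂) ∈ ω ∧ ω ∈ openConnIn (U \ F.inSet b) v v'} ↔
      ω₂ ∩ Eg ∈ explEvent (F.inSet b) (F.annSet b top) U R ∩
        {ω | ∀ r ∈ R, ∀ r₂ ∈ R, ∃ v ∈ U \ F.inSet b, ∃ v' ∈ U \ F.inSet b,
          s(v, r) ∈ ω ∧ s(v', r₂) ∈ ω ∧ ω ∈ openConnIn (U \ F.inSet b) v v'} := by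
  have hag' : ∀ e : Sym2 V, (∃ v ∈ F.annSet b top, v ∈ e) →
      (e ∈ ω₁ ∩ Eg ↔ e ∈ ω₂ ∩ Eg) := by
    rintro e ⟨v, hv, hve⟩
    by_cases he : e ∈ Eg
    · simp only [Set.mem_inter_iff, he, and_true]
      exact hag e he ⟨v, hve, hv⟩
    · simp only [Set.mem_inter_iff, he, and_false]
  have hIn : ∀ u ∈ F.inSet b, ∀ v : V, s(u, v) ∈ ω₁ ∩ Eg ∪ ω₂ ∩ Eg →
      v ∈ F.inSet b ∪ F.annSet b top := by
    intro u hu v huv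
    have he : s(u, v) ∈ F.E := by
      rcases huv with h | h
      · exact Finset.mem_coe.1 (hEg h.2)
      · exact Finset.mem_coe.1 (hEg h.2)
    exact F.mem_inSet_or_annSet_of_adj hbt htop he (Sym2.mem_mk_left u v)
      (Sym2.mem_mk_right u v) hu
  have hev := Percolation.mem_explEvent_iff_of_agree_on_block (U := U) (R := R) hIn hag'
  rw [Set.mem_inter_iff, Set.mem_inter_iff, hev]
  refine and_congr_right fun hE => ⟨fun hW => ?_, fun hW => ?_⟩
  · exact rimWiredOff_of_agree_on_block hag' (hev.2 hE) hW
  · exact rimWiredOff_of_agree_on_block (fun e he => (hag' e he).symm) hE hW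

/-! ### A separator of a sub-annulus wires the rim off the inside -/

/-- An open path inside a part `A ⊆ In ∪ Blk` of the block region that misses the inside, issuing
from an explored vertex, runs inside `explSet ∖ In` (each step explores its endpoint).
[cite: BasuSapozhnikov2017ECP, §2 eq. (2.3)] -/
theorem pathIn_explSet_diff {In Blk A : Set V} {ω : BondConfig V} {v a : V}
    (hA : A ⊆ In ∪ Blk) (hAIn : ∀ z ∈ A, z ∉ In) (hv : v ∈ explSet In Blk ω)
    (h : PathIn (openGraph ω) A v a) : PathIn (openGraph ω) (explSet In Blk ω \ In) v a := by
  obtain ⟨hvA, h⟩ := h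
  refine ⟨⟨hv, hAIn v hvA⟩, ?_⟩
  induction h with
  | refl => exact Relation.ReflTransGen.refl
  | @tail b c _ hbc ih =>
    have hb : b ∈ explSet In Blk ω :=
      (show PathIn (openGraph ω) (explSet In Blk ω \ In) v b from ⟨⟨hv, hAIn v hvA⟩, ih⟩).right_mem.1
    exact ih.tail ⟨hbc.1, Percolation.mem_explSet_of_open_edge hb
      ((Percolation.openGraph_adj ω b c).1 hbc.1).1 (hA hbc.2), hAIn c hbc.2⟩

namespace ScaleFrame

variable [Fintype V] [DecidableEq V] (F : ScaleFrame V)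

/-- An edge of the frame graph is a frame pair. [cite: Kesten1986, §2] -/
theorem mem_E_of_mem_graph_edgeSet {e : Sym2 V} (h : e ∈ F.graph.edgeSet) : e ∈ F.E := by
  rw [ScaleFrame.graph, edgeSet_fromEdgeSet] at h
  exact h.1

/-- **A separator of a sub-annulus wires the rim off the inside** (Kesten's innermost open circuit,
in the planarity-free form of Basu–Sapozhnikov's uniqueness event). For the block `(b, bM^m)`
explored from `inSet b` and a lattice configuration with an open separator of the sub-annulus
`(bM^i, bM^{i+1})`, `i + 1 ≤ m`: any two rim vertices hang, through open edges, off two explored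
vertices outside `inSet b` joined by an open path inside `explSet ∖ inSet b`. Proof: a rim vertex
`r` (radius `≥ bM^m`) hangs off an explored `v` (radius `> bM^m - η > bM^i`); the exploring path of
`v`, read from `v`, stays above scale `bM^i` and off the separator `P` until it first meets
`P ∪ inSet(bM^i)` — at a vertex of `P`, for otherwise that vertex, the path back to `v` and the
edge `v r` would be a walk from `inSet(bM^i)` to the outside missing `P`; this piece and the open
paths joining the vertices of `P` inside the sub-annulus run inside `explSet ∖ inSet b`.
[cite: Kesten1986, §2, proof of Thm. 3] -/
theorem rimWiredOff_of_sepEvent {b M : ℝ} {m i : ℕ} (hb : 0 < b) (hM : 4 ≤ M) (him : i + 1 ≤ m)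
    (hη : F.η ≤ b) (hR : b * M ^ m + F.η ≤ F.Rmax) {ω : BondConfig V}
    (hω : ω ⊆ F.graph.edgeSet) (hsep : ω ∈ F.sepEvent (b * M ^ i) (b * M ^ (i + 1))) :
    ∀ r ∈ explRim (F.inSet b) (F.annSet b (b * M ^ m)) ω,
      ∀ r₂ ∈ explRim (F.inSet b) (F.annSet b (b * M ^ m)) ω,
        ∃ v ∈ explSet (F.inSet b) (F.annSet b (b * M ^ m)) ω \ F.inSet b,
          ∃ v' ∈ explSet (F.inSet b) (F.annSet b (b * M ^ m)) ω \ F.inSet b,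
            s(v, r) ∈ ω ∧ s(v', r₂) ∈ ω ∧
              ω ∈ openConnIn (explSet (F.inSet b) (F.annSet b (b * M ^ m)) ω \ F.inSet b) v v' := by
  classical
  set In : Set V := F.inSet b with hIn
  set Blk : Set V := F.annSet b (b * M ^ m) with hBlk
  set S : Set V := explSet In Blk ω with hS
  obtain ⟨P, hPann, hconn, hsepP⟩ := hsep
  have hη0 := F.η_pos
  have hbi : b ≤ b * M ^ i := le_mul_of_one_le_right hb.le (one_le_pow₀ (by linarith))
  have hi1 : b * M ^ i + b ≤ b * M ^ (i + 1) := scale_gap hb hM (Nat.lt_succ_self i)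
  have him' : b * M ^ (i + 1) ≤ b * M ^ m := scale_mono hb hM him
  have hannBlk : F.annSet (b * M ^ i) (b * M ^ (i + 1)) ⊆ In ∪ Blk := fun z ⟨hg, h1, h2⟩ =>
    Or.inr ⟨hg, by linarith, by linarith⟩
  have hannIn : ∀ z ∈ F.annSet (b * M ^ i) (b * M ^ (i + 1)), z ∉ In :=
    fun z ⟨_, h1, _⟩ ⟨_, h2⟩ => by linarith
  -- each rim vertex hangs off an explored vertex outside `In` joined inside `S ∖ In` to `P`
  have key : ∀ r ∈ explRim In Blk ω, ∃ v z : V, v ∈ S \ In ∧ s(v, r) ∈ ω ∧ z ∈ P ∧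
      PathIn (openGraph ω) (S \ In) v z := by
    intro r hr
    obtain ⟨-, v, hvS, hvr⟩ := Percolation.mem_explRim_iff.1 hr
    have hrIB : r ∉ In ∪ Blk := Percolation.explRim_disjoint hr
    have hvIB : v ∈ In ∪ Blk := Percolation.explSet_subset In Blk ω hvS
    have hvg : v ∈ F.good ∧ F.rad v ≤ b * M ^ m := by
      rcases hvIB with ⟨hg, h⟩ | ⟨hg, -, h⟩
      · exact ⟨hg, by linarith⟩
      · exact ⟨hg, h.le⟩
    have hvrE : s(v, r) ∈ F.E := F.mem_E_of_mem_graph_edgeSet (hω hvr)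
    obtain ⟨hrg, hrv⟩ := F.adj_good _ hvrE v (Sym2.mem_mk_left v r) r (Sym2.mem_mk_right v r)
      hvg.1 (by linarith [hvg.2])
    have hrad_r : b * M ^ m ≤ F.rad r := by
      by_contra hlt
      rcases le_or_gt (F.rad r) b with h | h
      · exact hrIB (Or.inl ⟨hrg, h⟩)
      · exact hrIB (Or.inr ⟨hrg, h, not_le.1 hlt⟩)
    have hrad_v : b * M ^ m - F.η < F.rad v := by
      have := (abs_lt.1 hrv).2
      linarith
    have hvIn : v ∉ In := fun ⟨_, h⟩ => by linarith
    have hv_lt : ¬ F.rad v ≤ b * M ^ i := fun h => by linarith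
    have hrOut : r ∈ F.outSet (b * M ^ i) (b * M ^ (i + 1)) := by
      rw [F.mem_outSet_iff_of_lt (by linarith : b * M ^ i < b * M ^ (i + 1))]
      intro _
      linarith
    by_cases hvP : v ∈ P
    · exact ⟨v, v, ⟨hvS, hvIn⟩, hvr, hvP, PathIn.refl ⟨hvS, hvIn⟩⟩
    -- the exploring path of `v`, read from `v` back to some `u ∈ In`
    obtain ⟨-, u, hu, huv⟩ := Percolation.mem_explSet_iff_exists.1 hvS
    have hp : PathIn (openGraph ω) (In ∪ Blk) v u :=
      (Percolation.mem_openConnIn_iff_pathIn.1 huv).symm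
    set Rg : Set V := (P ∪ F.inSet (b * M ^ i))ᶜ with hRg
    have hvRg : v ∈ Rg := fun h => h.elim hvP fun h' => hv_lt h'.2
    rcases hp.exit_or hvRg with hp' | ⟨a, z, -, hzRg, hzIB, haz, hpath⟩
    · exact absurd (Or.inr ⟨hu.1, hu.2.trans hbi⟩) hp'.right_mem.1
    have hz : z ∈ P ∪ F.inSet (b * M ^ i) := by
      by_contra h
      exact hzRg h
    have hpath' : PathIn (openGraph ω) (S \ In) v a :=
      pathIn_explSet_diff (fun x hx => hx.2)
        (fun x hx hxIn => hx.1 (Or.inr ⟨hxIn.1, hxIn.2.trans hbi⟩)) hvS hpath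
    have haS : a ∈ S := hpath'.right_mem.1
    have hazω : s(a, z) ∈ ω := ((Percolation.openGraph_adj ω a z).1 haz).1
    have hzS : z ∈ S := Percolation.mem_explSet_of_open_edge haS hazω hzIB
    rcases hz with hzP | hzIn
    · exact ⟨v, z, ⟨hvS, hvIn⟩, hvr, hzP, hpath'.tail haz ⟨hzS, hannIn z (hPann hzP)⟩⟩
    · -- `z` lies below scale `bM^i` and off `P`: the walk `z a … v r` misses the separator
      exfalso
      have hzP : z ∉ P := fun h => by
        obtain ⟨-, h1, -⟩ := hPann h
        exact absurd hzIn.2 (not_le.2 h1)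
      have hav : ω ∈ openConnIn (Rg ∩ (In ∪ Blk)) a v :=
        Percolation.openConnIn_reverse (Percolation.mem_openConnIn_iff_pathIn.2 hpath)
      obtain ⟨W₁, hW₁S, -⟩ := Percolation.exists_walk_of_mem_openConnIn hω hav
      have hza' : F.graph.Adj z a := (F.graph.mem_edgeSet.1 (hω hazω)).symm
      have hvr' : F.graph.Adj v r := F.graph.mem_edgeSet.1 (hω hvr)
      obtain ⟨t, ht, htP⟩ := hsepP z r hzIn hrOut (Walk.cons hza' (W₁.concat hvr'))
      rw [Walk.support_cons, List.mem_cons, Walk.support_concat, List.mem_append,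
        List.mem_singleton] at ht
      rcases ht with rfl | ht | rfl
      · exact hzP htP
      · exact (hW₁S t ht).1 (Or.inl htP)
      · exact hrIB (hannBlk (hPann htP))
  intro r hr r₂ hr₂
  obtain ⟨v, z, hv, hvr, hzP, hvz⟩ := key r hr
  obtain ⟨v₂, z₂, hv₂, hv₂r₂, hz₂P, hv₂z₂⟩ := key r₂ hr₂
  have hzz : PathIn (openGraph ω) (S \ In) z z₂ :=
    pathIn_explSet_diff hannBlk hannIn hvz.right_mem.1
      (Percolation.mem_openConnIn_iff_pathIn.1 (hconn z hzP z₂ hz₂P))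
  exact ⟨v, hv, v₂, hv₂, hvr, hv₂r₂,
    Percolation.mem_openConnIn_iff_pathIn.2 ((hvz.trans hzz).trans hv₂z₂.symm)⟩

end ScaleFrame

/-! ### The middle piece of the chain is an open crossing between the two rims -/

/-- **The middle piece as an open crossing.** On a nested pair of data — `ω ∈ {𝒞' = U_C, 𝒟' = R_C}`
(outer) and `ω ∈ {𝒞 = U_D, 𝒟 = R_D}` (inner) with `U_D ⊆ U_C`, `R_D ⊆ U_C` — "some inner-rim
vertex is joined inside `U_C ∖ U_D` to a vertex carrying an open edge to `R_C`" holds iff there is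
an open path inside `(U_C ∪ R_C) ∖ U_D` from `R_D` to `R_C`: append the edge; conversely cut the
path at its first exit from `U_C`, which happens along an open edge into the outer rim.
[cite: BasuSapozhnikov2017ECP, §2 (eq. (2.4)–(2.6))] -/
theorem midPiece_iff_openCrossing {In Blk In' Blk' UC RC UD RD : Set V} {ω : BondConfig V}
    (hC : ω ∈ explEvent In' Blk' UC RC) (hD : ω ∈ explEvent In Blk UD RD)
    (hUD : UD ⊆ UC) (hRD : RD ⊆ UC) :
    (∃ w'' ∈ RD, ∃ v ∈ UC, ∃ w ∈ RC, ω ∈ openConnIn (UC \ UD) w'' v ∧ s(v, w) ∈ ω) ↔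
      ω ∈ openCrossing ((UC ∪ RC) \ UD) RD RC := by
  have hRC : ∀ w ∈ RC, w ∉ UC := fun w hw hwU => by
    obtain ⟨h1, h2⟩ := Percolation.mem_explEvent_iff.1 hC
    rw [← h2] at hw
    rw [← h1] at hwU
    exact (Percolation.mem_explRim_iff.1 hw).1 hwU
  have _hD := hD
  constructor
  · rintro ⟨w'', hw'', v, hv, w, hw, h1, h2⟩
    refine ⟨w'', hw'', w, hw, ?_⟩
    have hvw : v ≠ w := fun h => hRC w hw (h ▸ hv)
    have hvS : v ∈ (UC ∪ RC) \ UD := ⟨Or.inl hv, h1.2.1.2⟩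
    have hwS : w ∈ (UC ∪ RC) \ UD := ⟨Or.inr hw, fun h => hRC w hw (hUD h)⟩
    exact Percolation.PlanarDuality.openConnIn_trans
      (Percolation.openConnIn_mono (Set.sdiff_subset_sdiff_left Set.subset_union_left) _ _ h1)
      (Percolation.openConnIn_of_adj hvS hwS h2 hvw)
  · rintro ⟨r', hr', r, hr, h⟩
    rw [Percolation.mem_openConnIn_iff_pathIn] at h
    obtain ⟨a, b, ha, hb, hbS, hab, hpath⟩ := h.exit (hRD hr') (hRC r hr)
    have hbRC : b ∈ RC := hbS.1.resolve_left hb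
    rw [Percolation.openGraph_adj] at hab
    refine ⟨r', hr', a, ha, b, hbRC, ?_, hab.1⟩
    rw [Percolation.mem_openConnIn_iff_pathIn]
    exact hpath.mono fun z hz => ⟨hz.1, hz.2.2⟩

/-! ### Measure-theoretic trivia for the random-cluster measure -/

section Tools

variable [Fintype V] [DecidableEq V] (G : SimpleGraph V) [DecidableRel G.Adj]

/-- At `p = 0` the random-cluster measure is the Dirac mass at the empty configuration: an event
missing `∅` is null. [cite: Grimmett2006, §1.2, eq. (1.2)] -/
theorem rcMeasure_real_eq_zero_of_p_eq_zero {q : ℝ} (hq : 0 < q) (B : Set V)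
    {A : Set (BondConfig V)} (hA : (∅ : BondConfig V) ∉ A) : (rcMeasure G 0 q B).real A = 0 := by
  classical
  have hp : (0 : ℝ) ∈ Set.Icc (0 : ℝ) 1 := ⟨le_rfl, zero_le_one⟩
  rw [rcMeasure_real_apply G hp hq B A]
  refine Finset.sum_eq_zero fun ω _ => ?_
  split_ifs with h
  · have hne : ω.Nonempty := by
      rw [Finset.nonempty_iff_ne_empty]
      rintro rfl
      exact hA (by simpa using h)
    rw [rcWeight, zero_pow (Finset.card_ne_zero.2 hne), zero_mul, zero_mul, zero_div]
  · rfl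

/-- A non-null event of the random-cluster measure contains a lattice configuration `ω ⊆ E(G)`.
[cite: Grimmett2006, §1.2, eq. (1.2)] -/
theorem exists_subset_edgeSet_of_rcMeasure_real_ne_zero {p q : ℝ} (hp : p ∈ Set.Icc (0 : ℝ) 1)
    (hq : 0 < q) (B : Set V) {A : Set (BondConfig V)} (h : (rcMeasure G p q B).real A ≠ 0) :
    ∃ ω ∈ A, ω ⊆ G.edgeSet := by
  by_contra hne
  push Not at hne
  refine h ?_
  rw [measureReal_congr (rcMeasure_ae_eq_of_forall_subset_edgeSet G hp hq B (A' := ∅)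
    fun ω hω => ?_), measureReal_empty]
  exact ⟨fun hA => (hne ω hA hω).elim, fun h => h.elim⟩

/-- For `0 < p < 1` every lattice configuration has positive mass, so an event containing one is
non-null. [cite: Grimmett2006, §1.2, eq. (1.2)] -/
theorem rcMeasure_real_pos_of_mem {p q : ℝ} (hp0 : 0 < p) (hp1 : p < 1) (hq : 0 < q) (B : Set V)
    {A : Set (BondConfig V)} {ω : BondConfig V} (hω : ω ⊆ G.edgeSet) (hA : ω ∈ A) :
    0 < (rcMeasure G p q B).real A := by
  classical
  have hp : p ∈ Set.Icc (0 : ℝ) 1 := ⟨hp0.le, hp1.le⟩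
  have hcoe : (↑(Set.toFinite ω).toFinset : Set (Sym2 V)) = ω := Set.Finite.coe_toFinset _
  have hsub : (Set.toFinite ω).toFinset ⊆ G.edgeFinset := fun e he => by
    rw [mem_edgeFinset]
    exact hω ((Set.Finite.mem_toFinset _).1 he)
  refine rcMeasure_real_pos_of_rcWeight_pos G hp hq B hsub (by rw [hcoe]; exact hA) ?_
  unfold rcWeight
  have : 0 < 1 - p := by linarith
  positivity

omit [Fintype V] [DecidableEq V] in
/-- A lattice configuration of `⟨E⟩` is its own trace on `E`. [folklore] -/
theorem inter_coe_eq_self_of_subset_edgeSet {E : Finset (Sym2 V)} {ω : BondConfig V}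
    (hω : ω ⊆ (fromEdgeSet (E : Set (Sym2 V))).edgeSet) : ω ∩ ↑E = ω :=
  Set.inter_eq_left.2 fun e he => by
    have h := hω he
    rw [edgeSet_fromEdgeSet] at h
    exact h.1

omit [DecidableEq V] in
/-- A lattice configuration of `G` is its own trace on `E(G)`. [folklore] -/
theorem inter_edgeFinset_eq_self_of_subset_edgeSet {ω : BondConfig V} (hω : ω ⊆ G.edgeSet) :
    ω ∩ ↑G.edgeFinset = ω := by
  rw [coe_edgeFinset]
  exact Set.inter_eq_left.2 hω

end Tools

end Literature.Probability.LatticeModels
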